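import Summits.NavierStokesRegularity.FluidComputer.GateBudgetZeno
import HarnessLib

/-!
# What no tuning can beat, part 4: the DRAIN-SPEED LAW `ã(t) ≤ tanh(Kt)` (sharp) and the general drain window

Cell `pub-fluidc`, blueprint seat bp1 (gen 21, BLOCK 2); continues `GateBudget.lean` → `GateBudgetArming.lean` →
`GateBudgetZeno.lean` (namespace `Summit.NavierStokesRegularity.FluidComputer.GateBudget`). HONEST FRAMING
(verbatim): low prior, high value-of-information experiment on Tao's machine paradigm; NOT a claim that NS blows
up. Everything concerns the five-mode quadratic circuit `fiveGateCircuit ε σ μ R K` on `ℝ⁵` (Tao's (5.5) of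
[Tao2016AveragedNS, §5.5] is the slice `delayCircuitWith K M ε`, `M = K¹⁰`, by `rfl`), started EXACTLY at (5.6)
`delayInit`; nothing is proved about the Navier–Stokes equations.

## What is proved (a fifth conservation-law limit: the TIMING FLOOR OF THE DRAIN)

* §1 THE DRAIN-SPEED LAW (`output_le_tanh`): along every exact trajectory from `delayInit`, for every `K ≥ 0` and
  ALL other couplings, `ã(t) ≤ tanh(Kt)` for `t ≥ 0`. Only `∂ₜã = Kd²` and `d² ≤ 1 - ã²` (energy) are used:
  `g = (1-ã)/(1+ã)` obeys `∂ₜg = -2Kd²/(1+ã)² ≥ -2K·g`, so `g(t) ≥ e^{-2Kt}`, i.e. `ã ≤ (1-e^{-2Kt})/(1+e^{-2Kt})`.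
  More generally THE RAPIDITY LAW (`deficitRatio_monotoneOn`, `deficitRatio_law`, `rapidity_law`): `t ↦ g(t)e^{2Kt}` is
  monotone on `[0,∞)`, i.e. the output rapidity `artanh ã` is `K`-Lipschitz from above — raising the output from level `θ₀`
  (time `s`) to `θ₁` (time `t`) needs `K(t-s) ≥ artanh θ₁ - artanh θ₀`, timed from when loading starts.
  It is SHARP: the bare drain `(0,0,0,sech Kt, tanh Kt)` is an exact unit-energy trajectory of the same circuit
  (for every `ε, σ, μ, R`) with `ã = tanh(Kt)` (`bareDrain_solves`, `bareDrain_output`) — no pump `K : d → ã` can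
  load its output faster than when ALL the energy already sits in `d`. (The tree's `DelayWith.output_deficit_ge`,
  `1 - ã(t) ≥ e^{-2Kt}`, is the chord of this bound: `1 - tanh(Kt) = 2e^{-2Kt}/(1+e^{-2Kt}) ≥ e^{-2Kt}`.)
* §2 NECESSITY (`drain_speed_necessary`, `drain_window`): an output `ã(T) ≥ θ > 0` at `T ≥ 0` forces `θ < 1` and
  `log((1+θ)/(1-θ)) ≤ 2KT` (i.e. `KT ≥ artanh θ`), for every circuit; together with the Zeno law of part 3 the
  GENERAL DRAIN WINDOW `log((1+θ)/(1-θ))/(2T) ≤ K ≤ 4R²(2ε+σ)T/(μθ³)` (all couplings; part 3 had the lower edge for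
  Tao's family only, in the weaker chord form `log(1/(1-θ))/(2T) ≤ K`). For Tao's family (`taoFamily_output_le_tanh`,
  `taoFamily_drain_window_sharp`): `log((1+θ)/(1-θ))/(2T) ≤ K ≤ 12T/(ε²Mθ³)`.
* READING for a cascade of such gates: a stage that must hand on all but `δ` of its energy needs
  `KT ≥ artanh(1-δ) = ½log((2-δ)/δ)` of drain-phase time: the drain time `≈ log(2/δ)/(2K)` is a LAW of the pump,
  not an artefact of the bootstrap (the cell's sharp-time Theorem 5.3, `AmplitudeKnob.lean`, BUDGETS a drain time
  `L = 300 log K/K` for residual `K⁻²⁰`; the law says every tuning NEEDS `≥ (10 log K - log 100)/(2K) ≈ 5 log K/K` of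
  drain-phase time for Theorem 5.3's residual `200K⁻¹⁰`, and `≥ 10 log K/K` for `K⁻²⁰`).
[cite: Tao2016AveragedNS, §5.5 (5.5), (5.6), (ta-eq), (energy-con); §5.1 (pomp): the `sech/tanh` pump trajectory].
No named facts; 0 sorry.
-/

noncomputable section

namespace Summit.NavierStokesRegularity.FluidComputer.GateBudget

open Real Set Filter Topology
open Literature.Analysis.FluidPDE.Tao2016AveragedNS
open Thm53 (antitoneOn_intFactor monotoneOn_intFactor antitoneOn_sub_of_deriv_le monotoneOn_sub_of_le_deriv
  init_a init_b init_c init_d init_e)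

variable {ε σ μ R K : ℝ} {X : ℝ → Fin 5 → ℝ}

/-! ## §1 The drain-speed law `ã(t) ≤ tanh(Kt)` -/

/-- `d² ≤ 1 - ã²` along a unit-energy trajectory. [cite: Tao2016AveragedNS, §5.5 (energy-con)] -/
theorem d_sq_le_one_sub (hX : ∀ t, HasDerivAt X (fiveGateCircuit ε σ μ R K (X t)) t)
    (h0 : X 0 = delayInit) (t : ℝ) : X t 3 ^ 2 ≤ 1 - X t 4 ^ 2 := by
  have h := energy_init hX h0 t
  simp only [energy, Fin.sum_univ_five] at h
  nlinarith [sq_nonneg (X t 0), sq_nonneg (X t 1), sq_nonneg (X t 2)]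

/-- `ã ≥ 0` for `t ≥ 0` (`K ≥ 0`): the output only grows from `ã(0) = 0`. [cite: Tao2016AveragedNS, §5.5 (ta-eq)] -/
theorem e_nonneg (hX : ∀ t, HasDerivAt X (fiveGateCircuit ε σ μ R K (X t)) t) (h0 : X 0 = delayInit)
    (hK : 0 ≤ K) {t : ℝ} (ht : 0 ≤ t) : 0 ≤ X t 4 := by
  have h := e_monotone hX hK ht
  simpa [init_e h0] using h

/-- The DEFICIT RATIO `g = (1-ã)/(1+ã)` (`= e^{-2 artanh ã}`) decays no faster than `e^{-2Kt}`: `t ↦ g(t)·e^{2Kt}` is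
monotone on `[0, ∞)` along every exact trajectory of `fiveGateCircuit ε σ μ R K` from `delayInit`, `K ≥ 0`, ALL `ε, σ, μ, R`.
Proof: `∂ₜg = -2Kd²/(1+ã)²` and `d² ≤ 1-ã² = (1-ã)(1+ã)` (energy), so `∂ₜg ≥ -2Kg`. Equivalently: the output RAPIDITY `artanh ã`
grows at rate at most `K`. [cite: Tao2016AveragedNS, §5.5 (ta-eq), (energy-con)] -/
theorem deficitRatio_monotoneOn (hX : ∀ t, HasDerivAt X (fiveGateCircuit ε σ μ R K (X t)) t) (h0 : X 0 = delayInit)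
    (hK : 0 ≤ K) : MonotoneOn (fun t => (1 - X t 4) / (1 + X t 4) * exp (2 * K * t)) (Ici 0) := by
  have hpos : ∀ s ∈ Ici (0:ℝ), 0 < 1 + X s 4 := fun s hs => by
    have := e_nonneg hX h0 hK (show 0 ≤ s from hs); linarith
  have hg : ∀ s ∈ Ici (0:ℝ), HasDerivAt (fun r => (1 - X r 4) / (1 + X r 4))
      ((-(K * X s 3 ^ 2) * (1 + X s 4) - (1 - X s 4) * (K * X s 3 ^ 2)) / (1 + X s 4) ^ 2) s := by
    intro s hs
    exact ((hasDerivAt_e hX s).const_sub 1).div ((hasDerivAt_e hX s).const_add 1) (hpos s hs).ne'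
  have hmono := monotoneOn_intFactor (s := Ici 0) (f := fun r => (1 - X r 4) / (1 + X r 4))
    (f' := fun s => (-(K * X s 3 ^ 2) * (1 + X s 4) - (1 - X s 4) * (K * X s 3 ^ 2)) / (1 + X s 4) ^ 2)
    (g := fun _ => -(2 * K)) (G := fun s => -(2 * K) * s) (φ := fun _ => 0) (Φ := fun _ => 0)
    (convex_Ici 0) hg (fun s _ => by simpa using (hasDerivAt_id' s).const_mul (-(2 * K)))
    (fun s _ => hasDerivAt_const s (0 : ℝ)) ?_
  · have e : (fun t => (1 - X t 4) / (1 + X t 4) * exp (2 * K * t))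
        = (fun t => (1 - X t 4) / (1 + X t 4) * exp (-(-(2 * K) * t)) - 0) := by
      funext t; simp [neg_mul]
    rw [e]; exact hmono
  · intro s hs
    have h1 := hpos s hs
    have hd := d_sq_le_one_sub hX h0 s
    have hepos : 0 < exp (-(-(2 * K) * s)) := exp_pos _
    have key : 0 ≤ (-(K * X s 3 ^ 2) * (1 + X s 4) - (1 - X s 4) * (K * X s 3 ^ 2)) / (1 + X s 4) ^ 2
        - -(2 * K) * ((1 - X s 4) / (1 + X s 4)) := by
      have e1 : (-(K * X s 3 ^ 2) * (1 + X s 4) - (1 - X s 4) * (K * X s 3 ^ 2)) / (1 + X s 4) ^ 2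
          - -(2 * K) * ((1 - X s 4) / (1 + X s 4))
          = 2 * K * ((1 - X s 4 ^ 2) - X s 3 ^ 2) / (1 + X s 4) ^ 2 := by
        field_simp
        ring
      rw [e1]
      apply div_nonneg _ (sq_nonneg _)
      nlinarith
    simpa using mul_nonneg key hepos.le

/-- **THE RAPIDITY LAW** (ratio form): for `0 ≤ s ≤ t`, `(1-ã(s))/(1+ã(s)) ≤ (1-ã(t))/(1+ã(t)) · e^{2K(t-s)}` — from ANY
intermediate output level the deficit ratio decays no faster than `e^{-2K(t-s)}`; this is the form a cascade stage uses (the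
hand-off phase is timed from when loading starts, not from `t = 0`). [cite: Tao2016AveragedNS, §5.5 (ta-eq), (energy-con)] -/
theorem deficitRatio_law (hX : ∀ t, HasDerivAt X (fiveGateCircuit ε σ μ R K (X t)) t) (h0 : X 0 = delayInit)
    (hK : 0 ≤ K) {s t : ℝ} (hs : 0 ≤ s) (hst : s ≤ t) :
    (1 - X s 4) / (1 + X s 4) ≤ (1 - X t 4) / (1 + X t 4) * exp (2 * K * (t - s)) := by
  have h := deficitRatio_monotoneOn hX h0 hK (show s ∈ Ici (0:ℝ) from hs)
    (show t ∈ Ici (0:ℝ) from le_trans hs hst) hst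
  simp only at h
  have hq : exp (2 * K * s) * exp (-(2 * K * s)) = 1 := by rw [← exp_add]; simp
  have hsplit : exp (2 * K * (t - s)) = exp (2 * K * t) * exp (-(2 * K * s)) := by
    rw [← exp_add]; ring_nf
  calc (1 - X s 4) / (1 + X s 4) = (1 - X s 4) / (1 + X s 4) * (exp (2 * K * s) * exp (-(2 * K * s))) := by
        rw [hq, mul_one]
    _ = (1 - X s 4) / (1 + X s 4) * exp (2 * K * s) * exp (-(2 * K * s)) := by ring
    _ ≤ (1 - X t 4) / (1 + X t 4) * exp (2 * K * t) * exp (-(2 * K * s)) :=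
        mul_le_mul_of_nonneg_right h (exp_pos _).le
    _ = (1 - X t 4) / (1 + X t 4) * exp (2 * K * (t - s)) := by rw [hsplit]; ring

/-- **THE RAPIDITY LAW** (logarithmic form): the output rapidity `artanh ã = ½ log((1+ã)/(1-ã))` is `K`-Lipschitz from above —
for `0 ≤ s ≤ t` with `ã(t) < 1`, `log((1+ã(t))/(1-ã(t))) ≤ log((1+ã(s))/(1-ã(s))) + 2K(t-s)`: raising the output from level
`θ₀` to level `θ₁` takes time at least `(artanh θ₁ - artanh θ₀)/K`, whatever the clock, seed, amplifier and rotor do.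
[cite: Tao2016AveragedNS, §5.5 (ta-eq), (energy-con)] -/
theorem rapidity_law (hX : ∀ t, HasDerivAt X (fiveGateCircuit ε σ μ R K (X t)) t) (h0 : X 0 = delayInit)
    (hK : 0 ≤ K) {s t : ℝ} (hs : 0 ≤ s) (hst : s ≤ t) (h1 : X t 4 < 1) :
    Real.log ((1 + X t 4) / (1 - X t 4)) ≤ Real.log ((1 + X s 4) / (1 - X s 4)) + 2 * K * (t - s) := by
  have h := deficitRatio_law hX h0 hK hs hst
  have hps : 0 < 1 + X s 4 := by have := e_nonneg hX h0 hK hs; linarith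
  have hpt : 0 < 1 + X t 4 := by have := e_nonneg hX h0 hK (le_trans hs hst); linarith
  have hmt : 0 < 1 - X t 4 := by linarith
  have hms : 0 < 1 - X s 4 := by have := e_monotone hX hK hst; linarith
  have hlog := Real.log_le_log (div_pos hms hps) h
  rw [Real.log_mul (div_pos hmt hpt).ne' (exp_pos _).ne', Real.log_exp, Real.log_div hms.ne' hps.ne',
    Real.log_div hmt.ne' hpt.ne'] at hlog
  rw [Real.log_div hpt.ne' hmt.ne', Real.log_div hps.ne' hms.ne']
  linarith

/-- **THE DRAIN-SPEED LAW** (exponential form): `ã(t)·(1 + e^{-2Kt}) ≤ 1 - e^{-2Kt}` for `t ≥ 0`, `K ≥ 0`, along every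
exact trajectory of `fiveGateCircuit ε σ μ R K` from `delayInit`, for ALL `ε, σ, μ, R` (`deficitRatio_law` from `s = 0`,
where `ã = 0`). [cite: Tao2016AveragedNS, §5.5 (ta-eq), (energy-con)] -/
theorem output_exp_bound (hX : ∀ t, HasDerivAt X (fiveGateCircuit ε σ μ R K (X t)) t) (h0 : X 0 = delayInit)
    (hK : 0 ≤ K) {t : ℝ} (ht : 0 ≤ t) :
    X t 4 * (1 + exp (-(2 * K * t))) ≤ 1 - exp (-(2 * K * t)) := by
  have h := deficitRatio_law hX h0 hK le_rfl ht
  simp only [init_e h0, sub_zero, add_zero, div_one] at h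
  have h1 : 0 < 1 + X t 4 := by have := e_nonneg hX h0 hK ht; linarith
  have hq : exp (-(2 * K * t)) * exp (2 * K * t) = 1 := by rw [← exp_add]; simp
  have h2 : exp (-(2 * K * t)) ≤ (1 - X t 4) / (1 + X t 4) :=
    calc exp (-(2 * K * t)) = exp (-(2 * K * t)) * 1 := (mul_one _).symm
      _ ≤ exp (-(2 * K * t)) * ((1 - X t 4) / (1 + X t 4) * exp (2 * K * t)) :=
          mul_le_mul_of_nonneg_left h (exp_pos _).le
      _ = (1 - X t 4) / (1 + X t 4) * (exp (-(2 * K * t)) * exp (2 * K * t)) := by ring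
      _ = (1 - X t 4) / (1 + X t 4) := by rw [hq, mul_one]
  rw [le_div_iff₀ h1] at h2
  nlinarith

/-- `tanh x = (1 - e^{-2x})/(1 + e^{-2x})`. [folklore] -/
theorem tanh_eq_exp_neg_two (x : ℝ) : tanh x = (1 - exp (-(2 * x))) / (1 + exp (-(2 * x))) := by
  rw [Real.tanh_eq]
  have h1 : exp (-(2 * x)) = exp (-x) * exp (-x) := by rw [← exp_add]; ring_nf
  have h2 : exp x * exp (-x) = 1 := by rw [← exp_add]; simp
  have hx : 0 < exp x := exp_pos x
  rw [div_eq_div_iff (by positivity) (by positivity), h1]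
  nlinarith [h2]

/-- **THE DRAIN-SPEED LAW**: `ã(t) ≤ tanh(Kt)` (`t ≥ 0`, `K ≥ 0`) along every exact trajectory of
`fiveGateCircuit ε σ μ R K` from `delayInit`, for ALL `ε, σ, μ, R` — no drain pump can load its output faster than
the bare drain does (sharpness: `bareDrain_output`). [cite: Tao2016AveragedNS, §5.5 (ta-eq), (energy-con); §5.1 (pomp)] -/
theorem output_le_tanh (hX : ∀ t, HasDerivAt X (fiveGateCircuit ε σ μ R K (X t)) t) (h0 : X 0 = delayInit)
    (hK : 0 ≤ K) {t : ℝ} (ht : 0 ≤ t) : X t 4 ≤ tanh (K * t) := by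
  have h := output_exp_bound hX h0 hK ht
  rw [tanh_eq_exp_neg_two, le_div_iff₀ (by positivity), show 2 * (K * t) = 2 * K * t by ring]
  exact h

/-- The chord form (the tree's `DelayWith.output_deficit_ge` for the general circuit, now with the factor `2/(1+e^{-2Kt})`):
`1 - ã(t) ≥ 2e^{-2Kt}/(1 + e^{-2Kt}) ≥ e^{-2Kt}`. [cite: Tao2016AveragedNS, §5.5 (ta-eq)] -/
theorem output_deficit_ge (hX : ∀ t, HasDerivAt X (fiveGateCircuit ε σ μ R K (X t)) t) (h0 : X 0 = delayInit)
    (hK : 0 ≤ K) {t : ℝ} (ht : 0 ≤ t) : exp (-(2 * K * t)) ≤ 1 - X t 4 := by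
  have h := output_exp_bound hX h0 hK ht
  nlinarith [mul_nonneg (e_nonneg hX h0 hK ht) (exp_pos (-(2 * K * t))).le]

/-! ## §1b Sharpness: the bare drain `(0, 0, 0, sech Kt, tanh Kt)` is an exact trajectory with `ã = tanh(Kt)` -/

/-- The bare-drain trajectory: all the energy in `d` at time 0, pumped into `ã` by the drain alone. [cite: Tao2016AveragedNS, §5.1 (pomp)] -/
def bareDrain (K : ℝ) (t : ℝ) : Fin 5 → ℝ := ![0, 0, 0, (cosh (K * t))⁻¹, sinh (K * t) / cosh (K * t)]

/-- Its output is `tanh(Kt)`. [cite: Tao2016AveragedNS, §5.1 (pomp)] -/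
theorem bareDrain_output (K t : ℝ) : bareDrain K t 4 = tanh (K * t) := by
  simp [bareDrain, Real.tanh_eq_sinh_div_cosh]

/-- It has unit energy. [cite: Tao2016AveragedNS, §5.1 (pomp)] -/
theorem bareDrain_energy (K t : ℝ) : energy (bareDrain K t) = 1 := by
  have hc : cosh (K * t) ≠ 0 := (cosh_pos _).ne'
  simp only [energy, Fin.sum_univ_five, bareDrain, Matrix.cons_val_zero, Matrix.cons_val_one, Matrix.head_cons,
    Matrix.cons_val_two, Matrix.tail_cons, Matrix.cons_val_three, Matrix.cons_val_four]
  field_simp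
  nlinarith [Real.cosh_sq (K * t)]

/-- **Sharpness of the drain-speed law**: the bare drain solves `fiveGateCircuit ε σ μ R K` for EVERY `ε, σ, μ, R`
(the clock, seed, amplifier and rotor all vanish on it). [cite: Tao2016AveragedNS, §5.1 (pomp), §5.5 (5.5)] -/
theorem bareDrain_solves (ε σ μ R K : ℝ) (t : ℝ) :
    HasDerivAt (bareDrain K) (fiveGateCircuit ε σ μ R K (bareDrain K t)) t := by
  have hc : cosh (K * t) ≠ 0 := (cosh_pos _).ne'
  have hlin : HasDerivAt (fun s : ℝ => K * s) K t := by simpa using (hasDerivAt_id' t).const_mul K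
  have hcosh : HasDerivAt (fun s => cosh (K * s)) (sinh (K * t) * K) t := (Real.hasDerivAt_cosh (K * t)).comp t hlin
  have hsinh : HasDerivAt (fun s => sinh (K * s)) (cosh (K * t) * K) t := (Real.hasDerivAt_sinh (K * t)).comp t hlin
  have hd : HasDerivAt (fun s => (cosh (K * s))⁻¹) (-(sinh (K * t) * K) / cosh (K * t) ^ 2) t := hcosh.inv hc
  have he : HasDerivAt (fun s => sinh (K * s) / cosh (K * s))
      ((cosh (K * t) * K * cosh (K * t) - sinh (K * t) * (sinh (K * t) * K)) / cosh (K * t) ^ 2) t :=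
    hsinh.div hcosh hc
  refine hasDerivAt_pi.2 fun i => ?_
  fin_cases i
  · simpa [bareDrain, fiveGateCircuit] using hasDerivAt_const t (0 : ℝ)
  · simpa [bareDrain, fiveGateCircuit] using hasDerivAt_const t (0 : ℝ)
  · simpa [bareDrain, fiveGateCircuit] using hasDerivAt_const t (0 : ℝ)
  · refine hd.congr_deriv ?_
    simp only [bareDrain, fiveGateCircuit, Matrix.cons_val_zero, Matrix.cons_val_one, Matrix.head_cons,
      Matrix.cons_val_two, Matrix.tail_cons, Matrix.cons_val_three, Matrix.cons_val_four, Fin.reduceFinMk]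
    field_simp
    ring
  · refine he.congr_deriv ?_
    have key : cosh (K * t) * K * cosh (K * t) - sinh (K * t) * (sinh (K * t) * K) = K := by
      linear_combination K * Real.cosh_sq_sub_sinh_sq (K * t)
    rw [key]
    simp only [bareDrain, fiveGateCircuit, Matrix.cons_val_zero, Matrix.cons_val_one, Matrix.head_cons,
      Matrix.cons_val_two, Matrix.tail_cons, Matrix.cons_val_three, Matrix.cons_val_four, Fin.reduceFinMk]
    rw [inv_pow, div_eq_mul_inv]

/-! ## §2 Necessity: `KT ≥ artanh θ`; the general drain window -/

/-- **Drain-speed necessity**: an output `ã(T) ≥ θ > 0` at `T ≥ 0` forces `θ < 1` and `log((1+θ)/(1-θ)) ≤ 2KT`,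
for every `K ≥ 0` and ALL other couplings. [cite: Tao2016AveragedNS, §5.5 (ta-eq), (energy-con)] -/
theorem drain_speed_necessary (hX : ∀ t, HasDerivAt X (fiveGateCircuit ε σ μ R K (X t)) t) (h0 : X 0 = delayInit)
    (hK : 0 ≤ K) {T θ : ℝ} (hT : 0 ≤ T) (hθ : 0 < θ) (hθe : θ ≤ X T 4) :
    θ < 1 ∧ Real.log ((1 + θ) / (1 - θ)) ≤ 2 * K * T := by
  have h := output_exp_bound hX h0 hK hT
  set q := exp (-(2 * K * T)) with hq
  have hq0 : 0 < q := exp_pos _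
  have hθq : θ * (1 + q) ≤ 1 - q := le_trans (mul_le_mul_of_nonneg_right hθe (by positivity)) h
  have hθ1 : θ < 1 := by nlinarith
  refine ⟨hθ1, ?_⟩
  have h1θ : 0 < 1 - θ := by linarith
  have hqE : q * exp (2 * K * T) = 1 := by rw [hq, ← exp_add]; simp
  have hfrac : (1 + θ) / (1 - θ) ≤ exp (2 * K * T) := by
    rw [div_le_iff₀ h1θ]
    have h3 : q * (1 + θ) ≤ 1 - θ := by nlinarith
    calc 1 + θ = exp (2 * K * T) * (q * (1 + θ)) := by
          rw [← mul_assoc, mul_comm (exp _) q, hqE, one_mul]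
      _ ≤ exp (2 * K * T) * (1 - θ) := mul_le_mul_of_nonneg_left h3 (exp_pos _).le
  have := Real.log_le_log (div_pos (by linarith) h1θ) hfrac
  rwa [Real.log_exp] at this

/-- **THE GENERAL DRAIN WINDOW**: an output `ã(T) ≥ θ > 0` needs `log((1+θ)/(1-θ))/(2T) ≤ K` (the drain is fast enough
to load `ã` in time `T`: this part) AND `Kθ³μ ≤ 4R²(2ε+σ)T` (the Zeno law of part 3: the drain is slow enough not to
throttle the rotor). [cite: Tao2016AveragedNS, §5.5 (ta-eq), (dora), (b-eq), (energy-con)] -/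
theorem drain_window (hX : ∀ t, HasDerivAt X (fiveGateCircuit ε σ μ R K (X t)) t) (h0 : X 0 = delayInit)
    (hε : 0 ≤ ε) (hσ : 0 ≤ σ) (hμ : 0 < μ) (hR : 0 ≤ R) (hK : 0 < K) {T θ : ℝ} (hT : 0 < T) (hθ : 0 < θ)
    (hθe : θ ≤ X T 4) :
    Real.log ((1 + θ) / (1 - θ)) / (2 * T) ≤ K ∧ K * θ ^ 3 * μ ≤ 4 * R ^ 2 * ((2 * ε + σ) * T) := by
  refine ⟨?_, design_inequality hX h0 hε hσ hμ hR hK hT.le hθ hθe⟩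
  have h := (drain_speed_necessary hX h0 hK.le hT.le hθ hθe).2
  rw [div_le_iff₀ (by positivity)]
  linarith

/-- Tao's family: `ã(t) ≤ tanh(Kt)` for every exact trajectory of `delayCircuitWith K M ε` (any `M`, any `ε`), `t ≥ 0`.
[cite: Tao2016AveragedNS, §5.5 (5.5), (ta-eq)] -/
theorem taoFamily_output_le_tanh {K M ε : ℝ} {X : ℝ → Fin 5 → ℝ}
    (hX : ∀ t, HasDerivAt X (delayCircuitWith K M ε (X t)) t) (h0 : X 0 = delayInit) (hK : 0 ≤ K)
    {t : ℝ} (ht : 0 ≤ t) : X t 4 ≤ tanh (K * t) := by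
  rw [delayCircuitWith_eq_fiveGate] at hX
  exact output_le_tanh hX h0 hK ht

/-- Tao's family, the sharpened two-sided DRAIN WINDOW (cf. part 3's `taoFamily_drain_window`, lower edge in chord form):
`log((1+θ)/(1-θ))/(2T) ≤ K ≤ 12T/(ε²Mθ³)`. [cite: Tao2016AveragedNS, §5.5 Theorem 5.3, (ta-eq), (dora)] -/
theorem taoFamily_drain_window_sharp {K M ε : ℝ} {X : ℝ → Fin 5 → ℝ}
    (hX : ∀ t, HasDerivAt X (delayCircuitWith K M ε (X t)) t) (h0 : X 0 = delayInit)
    (hK : 0 < K) (hM : 0 < M) (hε : 0 < ε) (hε1 : ε ≤ 1) {T θ : ℝ} (hT : 0 < T) (hθ : 0 < θ)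
    (hθe : θ ≤ X T 4) :
    Real.log ((1 + θ) / (1 - θ)) / (2 * T) ≤ K ∧ K ≤ 12 * T / (ε ^ 2 * M * θ ^ 3) := by
  refine ⟨?_, (taoFamily_drain_window hX h0 hK hM hε hε1 hT hθ hθe).2⟩
  have hX' := hX
  rw [delayCircuitWith_eq_fiveGate] at hX'
  have h := (drain_speed_necessary hX' h0 hK.le hT.le hθ hθe).2
  rw [div_le_iff₀ (by positivity)]
  linarith

end Summit.NavierStokesRegularity.FluidComputer.GateBudget
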